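import Summits.BirchSwinnertonDyer.BirchSwinnertonDyer.Theorems.EisensteinPrimesMazurMCOnCellBTwistbackSubrowPartnerGiven
import Summits.BirchSwinnertonDyer.BirchSwinnertonDyer.Theorems.EisensteinPrimesMazurMCOnCellBTwistbackSubrowCarrierBernoulliEven
import HarnessLib

/-!
# Crux 3 `MazurMCOnCellB` (stmt-BirchSwinnertonDyer-19033), line `twistback` v5 — stub 6′ (∃-PARTNER) AT a non-split
# X2b pair `(W, p)`, `K` GIVEN, at EVERY odd `p` for ARBITRARY line characters: LEAD g11's four `K`-given doors
# (p654672) with the class number replaced by the generalized-Bernoulli unit of the twisted character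

LEAD bsd-line-x2-p1 g12 (2026-08-28). HONEST FRAMING (cell `bsd-eis`, run/shared/lean/pub/bsd-eis/): conditional
theorems only. Named facts taken as hypotheses BY NAME (nothing asserted, nothing introduced): the route's
`PublishedInputs` (stmt-…-19037), Disegni 2020 Thm. 4(1) (PUB), Greenberg–Vatsal Thm. (3.11) (PUB), and — in the
`_of_thmE` variants only — Dokchitser–Dokchitser 2010 Thm. 1.4 (PUB) and the `p`-converse
`KellerYin2024.thmE_pConverse_semistable_OPEN` (UNREFEREED PREPRINT; stub 3a of the registered skeleton v5 carries
Keller–Yin Thms. D ∧ E). `--supports` stmt-BirchSwinnertonDyer-19033; no `def`, no `sorry`; closes no registered stub;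
no summit statement, no Mazur main conjecture and no BSD is proved for any curve; 0 cells / labels / tiers move.

WHAT. Sub-population (iii) of the registered open stub `stub_upperPartnerOffSubrow` (skeleton v5, sha256 355e1eaf…):
non-split X2b pairs at `p ≠ 3`. p654672's doors give the stub's conclusion at `(W, p)` from an admissible `K` with a
CLASS-NUMBER condition, which presupposes a QUADRATIC unramified character (automatic only at `p = 3`). Here the same
four doors take instead the generalized-Bernoulli UNIT `‖B_{1,θ}‖_p = 1` of the twisted character (`θ(a) =
ω̃((ψ(a)·(a/|d_K|))⁻¹)`, period `d·|d_K|`, first shape; `ω̃((φ(a)·(a/|d_K|))⁻¹)`, period `m·|d_K|`, second shape),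
valid for characters of ANY order, hence at every odd `p`:
* §1 `upperPartner_at_of_ramifiedOdd_of_bernoulliUnit{,_of_thmE}` (line of `E` ramified-odd);
* §2 `upperPartner_at_of_unramifiedEven_of_bernoulliUnit{,_of_thmE}` (line unramified-even).
So at every odd `p`, (∃-PARTNER) at a non-split X2b pair of local balance one is reduced to the EXISTENCE of ONE
admissible `K` (Heegner for `N_W·N₀` and `p`, `d_K ≡ 1 (4)`, `d_K < −4`, prime to the levels) with ONE Bernoulli unit
(+ `r_an(E^{(d_K)}) = 1`, or Keller–Yin Thm. E). That existence is printed only at `p = 3` (Nakagawa–Horie–Taya,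
class-number form; LEAD g11 p655083/p655437): at `p ≥ 5` Wiles 2015 / Beckwith 2017 prescribe no local condition at
`p` and control `p ∤ h`, not a Bernoulli number of a non-quadratic character — OPEN (verdict g12 §2 (iii)).

References: [GreenbergVatsal2000] Thm. (1.3), §2 p. 28, §3 Thm. (3.11); [Washington1997] Thm. 4.2, Thm. 5.11;
[KellerYin2024] Thm. E (PRE); [DokchitserDokchitserAnnals2010] Thm. 1.4; [Disegni2020] Thm. 4; [Wuthrich2014] Thm. 16.
-/

set_option autoImplicit false

-- `Summit.BirchSwinnertonDyer.BirchSwinnertonDyer.…`: the summit and its single sub-problem share a name.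
set_option linter.dupNamespace false

noncomputable section

open scoped Classical MatrixGroups ModularForm NumberTheorySymbols

open CongruenceSubgroup WeierstrassCurve NumberField IsDedekindDomain Field DirichletCharacter Rat.HeightOneSpectrum
  Literature.NumberTheory.EllipticCurves Literature.NumberTheory.GaloisRepresentations
  Literature.NumberTheory.EllipticCurves.ModularForms Literature.NumberTheory.QuadraticFields
  Literature.NumberTheory.EllipticCurves.Rank1Residual Literature.NumberTheory.EllipticCurves.Rank1Residual.Typed
  Literature.NumberTheory.EllipticCurves.Wuthrich2014 Literature.NumberTheory.EllipticCurves.GreenbergVatsal2000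
  Literature.NumberTheory.EllipticCurves.Disegni2020 Literature.NumberTheory.EllipticCurves.KellerYin2024
  Summit.BirchSwinnertonDyer.Rank1Residual Summit.BirchSwinnertonDyer.Rank1Residual.X2
  Summit.BirchSwinnertonDyer.BirchSwinnertonDyer.Theses
  Summit.BirchSwinnertonDyer.BirchSwinnertonDyer.Theorems.EisensteinPrimesLineWeilRelation
  Summit.BirchSwinnertonDyer.BirchSwinnertonDyer.Theorems.EisensteinPrimesMazurMCOnCellBTwistbackKLFlatPartner
  Summit.BirchSwinnertonDyer.BirchSwinnertonDyer.Theorems.EisensteinPrimesMazurMCOnCellBTwistbackLamOnePartner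
  Summit.BirchSwinnertonDyer.BirchSwinnertonDyer.Theorems.EisensteinPrimesMazurMCOnCellBTwistbackSubrowCarrier
  Summit.BirchSwinnertonDyer.BirchSwinnertonDyer.Theorems.EisensteinPrimesMazurMCOnCellBTwistbackSubrowCarrierEven
  Summit.BirchSwinnertonDyer.BirchSwinnertonDyer.Theorems.EisensteinPrimesMazurMCOnCellBTwistbackPartnerClassNumberLift
  Summit.BirchSwinnertonDyer.BirchSwinnertonDyer.Theorems.EisensteinPrimesLinePsiAtMultiplicativePrime
  Summit.BirchSwinnertonDyer.BirchSwinnertonDyer.Theorems.EisensteinPrimesLinePhiAtMultiplicativePrime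
  Summit.BirchSwinnertonDyer.BirchSwinnertonDyer.Theorems.EisensteinPrimesMazurMCOnCellBTwistbackSubrowCarrierBernoulli
  Summit.BirchSwinnertonDyer.BirchSwinnertonDyer.Theorems.EisensteinPrimesMazurMCOnCellBTwistbackSubrowCarrierBernoulliEven
  Summit.BirchSwinnertonDyer.BirchSwinnertonDyer.Theorems.EisensteinPrimesMazurMCOnCellBTwistbackSubrowPartnerGiven

namespace Summit.BirchSwinnertonDyer.BirchSwinnertonDyer.Theorems.EisensteinPrimesMazurMCOnCellBTwistbackSubrowPartnerGivenBernoulli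

/-! ## §1. FIRST shape (line of `E` ramified-odd), `K` given: stub 6 at `(W, p)` -/

section Given

variable (W : WeierstrassCurve ℚ) [W.IsElliptic] [W.IsGloballyMinimal] (p : ℕ) [Fact p.Prime]

/-- **Stub 6 (∃-PARTNER) AT `(W, p)`, FIRST shape, PUBLISHED inputs + the twist's analytic rank.** Non-split X2b
`(W, p)`; a rational line RAMIFIED-ODD with primitive `(φ, ψ)`, `ψ` of ANY order (`p ≥ 5` included); `S₀ ∌ p`, `W` good off
`S₀ ∪ {p}`, LOCAL BALANCE ONE; an admissible `K` (Heegner for `N_W` and `p`, `d_K` odd `< −4`) with the places of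
`S₀` dividing a level `N₀` for which `K` is Heegner, `gcd(m, d_K) = gcd(d, d_K) = 1`, the generalized-Bernoulli UNIT
`‖B_{1,θ}‖_p = 1`, `θ(a) = ω̃((ψ(a)·(a/|d_K|))⁻¹)` (period `d·|d_K|`), and `ord_{s=1} L(E^{(d_K)}, s) = 1` ⟹ the partner clause of `stub_upperPartner` at `(W, p)`. LEAD g10's door p645525 §3 fed
with the Bernoulli carrier `…SubrowCarrierBernoulli` (LEAD g12; p654672 §1 is the case `ψ` quadratic). Inputs BY NAME: `PublishedInputs`, Disegni Thm. 4(1), GV Thm. (3.11) — all PUBLISHED.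
[cite: GreenbergVatsal2000, §3 Thm. (3.11) (p. 43)] [cite: Disegni2020, Thm. 4 (§3.2)] [cite: Wuthrich2014, Thm. 16 (p. 397)] -/
theorem upperPartner_at_of_ramifiedOdd_of_bernoulliUnit (hP : EisensteinPrimes.PublishedInputs)
    (hDis : padicBSD_rankOne_nonsplitMult) (h311 : thm311_hasUnitContent_iff_and_order_eq_of_lineRamifiedEven)
    (hc : X2.CellB W p) (hns : ¬ W.HasSplitMultiplicativeReductionAtPrime p)
    {Φ₀ : AddSubgroup (geomTorsion W (p : ℤ))} (hΦ : IsRationalLine W p Φ₀)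
    (hram : ¬ LineUnramifiedAt W p Φ₀) (hodd : LineOdd W p Φ₀)
    {m : ℕ} [NeZero m] (φ : DirichletCharacter (ZMod p) m) {d : ℕ} [NeZero d]
    (ψ : DirichletCharacter (ZMod p) d) (hφ : φ.IsPrimitive) (hψ : ψ.IsPrimitive) (hpm : p ∣ m)
    (hpd : ¬ p ∣ d)
    (hφ0 : ∀ (σ : absoluteGaloisGroup ℚ), ∀ P ∈ Φ₀,
      σ • P = (φ ((modNCyclotomicCharacter ℚ m σ : (ZMod m)ˣ) : ZMod m)).val • P)
    (hψ0 : ∀ (σ : absoluteGaloisGroup ℚ) (P : geomTorsion W (p : ℤ)),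
      σ • P - (ψ ((modNCyclotomicCharacter ℚ d σ : (ZMod d)ˣ) : ZMod d)).val • P ∈ Φ₀)
    (S₀ : Finset (HeightOneSpectrum (𝓞 ℚ))) (hS₀p : ∀ v ∈ S₀, ((p : ℕ) : 𝓞 ℚ) ∉ v.asIdeal)
    (hS : ∀ v : HeightOneSpectrum (𝓞 ℚ), v ∉ S₀ → ((p : ℕ) : 𝓞 ℚ) ∉ v.asIdeal → W.HasGoodReductionAt v)
    (hbal : 1 + ∑ v ∈ S₀, delta W p v =
      ∑ v ∈ S₀, ((if φ (Rat.HeightOneSpectrum.natGenerator v : ZMod m) =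
            (Rat.HeightOneSpectrum.natGenerator v : ZMod p)
          then sFactor p (Rat.HeightOneSpectrum.natGenerator v) else 0) +
        (if ψ (Rat.HeightOneSpectrum.natGenerator v : ZMod d) =
            (Rat.HeightOneSpectrum.natGenerator v : ZMod p)
          then sFactor p (Rat.HeightOneSpectrum.natGenerator v) else 0)))
    (K : Type) [Field K] [NumberField K] (hK : IsImaginaryQuadratic K)
    (hHN : SatisfiesHeegnerHypothesis (W.conductorNorm ℤ) K) (hHp : SatisfiesHeegnerHypothesis p K)
    (hoddK : Odd (NumberField.discr K)) (hlt : NumberField.discr K < -4)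
    {N₀ : ℕ} (hHN₀ : SatisfiesHeegnerHypothesis N₀ K)
    (hS₀N₀ : ∀ v ∈ S₀, Rat.HeightOneSpectrum.natGenerator v ∣ N₀)
    (hmK : m.Coprime (NumberField.discr K).natAbs) (hdK : d.Coprime (NumberField.discr K).natAbs)
    (hB : ‖twistedBernoulli p 1 (d * (NumberField.discr K).natAbs) (fun a : ℕ ↦ teichmullerLift p
        (ψ (a : ZMod d) * ((J((a : ℤ) | (NumberField.discr K).natAbs) : ℤ) : ZMod p))⁻¹)‖ = 1)
    (hr1 : (W.quadraticTwist (NumberField.discr K : ℚ)).analyticRank = 1) :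
    ∃ (K : Type) (_ : Field K) (_ : NumberField K), IsImaginaryQuadratic K ∧
      SatisfiesHeegnerHypothesis (W.conductorNorm ℤ) K ∧ SatisfiesHeegnerHypothesis p K ∧
      Odd (NumberField.discr K) ∧ NumberField.discr K < -4 ∧
      (W.quadraticTwist (NumberField.discr K : ℚ)).analyticRank = 1 ∧
      ∀ (Wd : WeierstrassCurve ℚ) [Wd.IsElliptic] [Wd.IsGloballyMinimal],
        (∃ C : VariableChange ℚ, C • Wd = W.quadraticTwist (NumberField.discr K : ℚ)) →
        MissingUpperBoundAt Wd p :=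
  upperPartner_at_of_klFlat_partner hP hDis h311 W p hc hns K hK hHN hHp hoddK hlt hr1
    (exists_klFlatCarrier_twist_of_ramifiedOdd_of_bernoulliUnit W p hc.2.1 hns hΦ hram hodd φ ψ hφ hψ hpm hpd hφ0 hψ0
      S₀ hS₀p hS hbal K hK hHp (discr_emod_four_eq_one_of_odd hK.1 hoddK) hlt hHN₀ hS₀N₀ hmK hdK hB)

/-- **Stub 6 (∃-PARTNER) AT `(W, p)`, FIRST shape, the analytic rank DERIVED** — the same data WITHOUT
`ord_{s=1} L(E^{(d_K)}, s) = 1`: w5's door p650387 (`(μ_an, λ_an) = (0, 1)` ⟹ corank `≤ 1` ⟹ `= 1` by parity ⟹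
`r_an = 1` by Keller–Yin Thm. E, PRE) fed with the Bernoulli carrier. Inputs BY NAME: `PublishedInputs`, Disegni Thm.
4(1), GV Thm. (3.11), Dokchitser (PUB); Keller–Yin Thm. E (PRE). [claim: KellerYin2024, status: under-review]
[cite: GreenbergVatsal2000, §3 Thm. (3.11) (p. 43)] [cite: DokchitserDokchitserAnnals2010, Thm. 1.4] [cite: Wuthrich2014, Thm. 16 (p. 397)] -/
theorem upperPartner_at_of_ramifiedOdd_of_bernoulliUnit_of_thmE (hP : EisensteinPrimes.PublishedInputs)
    (hDis : padicBSD_rankOne_nonsplitMult) (h311 : thm311_hasUnitContent_iff_and_order_eq_of_lineRamifiedEven)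
    (hDD : ∀ (V : WeierstrassCurve ℚ) [V.IsElliptic] (ℓ : ℕ) [Fact ℓ.Prime], selmerCorank_mod_two_eq V ℓ)
    (hKY : thmE_pConverse_semistable_OPEN)
    (hc : X2.CellB W p) (hns : ¬ W.HasSplitMultiplicativeReductionAtPrime p)
    {Φ₀ : AddSubgroup (geomTorsion W (p : ℤ))} (hΦ : IsRationalLine W p Φ₀)
    (hram : ¬ LineUnramifiedAt W p Φ₀) (hodd : LineOdd W p Φ₀)
    {m : ℕ} [NeZero m] (φ : DirichletCharacter (ZMod p) m) {d : ℕ} [NeZero d]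
    (ψ : DirichletCharacter (ZMod p) d) (hφ : φ.IsPrimitive) (hψ : ψ.IsPrimitive) (hpm : p ∣ m)
    (hpd : ¬ p ∣ d)
    (hφ0 : ∀ (σ : absoluteGaloisGroup ℚ), ∀ P ∈ Φ₀,
      σ • P = (φ ((modNCyclotomicCharacter ℚ m σ : (ZMod m)ˣ) : ZMod m)).val • P)
    (hψ0 : ∀ (σ : absoluteGaloisGroup ℚ) (P : geomTorsion W (p : ℤ)),
      σ • P - (ψ ((modNCyclotomicCharacter ℚ d σ : (ZMod d)ˣ) : ZMod d)).val • P ∈ Φ₀)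
    (S₀ : Finset (HeightOneSpectrum (𝓞 ℚ))) (hS₀p : ∀ v ∈ S₀, ((p : ℕ) : 𝓞 ℚ) ∉ v.asIdeal)
    (hS : ∀ v : HeightOneSpectrum (𝓞 ℚ), v ∉ S₀ → ((p : ℕ) : 𝓞 ℚ) ∉ v.asIdeal → W.HasGoodReductionAt v)
    (hbal : 1 + ∑ v ∈ S₀, delta W p v =
      ∑ v ∈ S₀, ((if φ (Rat.HeightOneSpectrum.natGenerator v : ZMod m) =
            (Rat.HeightOneSpectrum.natGenerator v : ZMod p)
          then sFactor p (Rat.HeightOneSpectrum.natGenerator v) else 0) +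
        (if ψ (Rat.HeightOneSpectrum.natGenerator v : ZMod d) =
            (Rat.HeightOneSpectrum.natGenerator v : ZMod p)
          then sFactor p (Rat.HeightOneSpectrum.natGenerator v) else 0)))
    (K : Type) [Field K] [NumberField K] (hK : IsImaginaryQuadratic K)
    (hHN : SatisfiesHeegnerHypothesis (W.conductorNorm ℤ) K) (hHp : SatisfiesHeegnerHypothesis p K)
    (hoddK : Odd (NumberField.discr K)) (hlt : NumberField.discr K < -4)
    {N₀ : ℕ} (hHN₀ : SatisfiesHeegnerHypothesis N₀ K)
    (hS₀N₀ : ∀ v ∈ S₀, Rat.HeightOneSpectrum.natGenerator v ∣ N₀)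
    (hmK : m.Coprime (NumberField.discr K).natAbs) (hdK : d.Coprime (NumberField.discr K).natAbs)
    (hB : ‖twistedBernoulli p 1 (d * (NumberField.discr K).natAbs) (fun a : ℕ ↦ teichmullerLift p
        (ψ (a : ZMod d) * ((J((a : ℤ) | (NumberField.discr K).natAbs) : ℤ) : ZMod p))⁻¹)‖ = 1) :
    ∃ (K : Type) (_ : Field K) (_ : NumberField K), IsImaginaryQuadratic K ∧
      SatisfiesHeegnerHypothesis (W.conductorNorm ℤ) K ∧ SatisfiesHeegnerHypothesis p K ∧
      Odd (NumberField.discr K) ∧ NumberField.discr K < -4 ∧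
      (W.quadraticTwist (NumberField.discr K : ℚ)).analyticRank = 1 ∧
      ∀ (Wd : WeierstrassCurve ℚ) [Wd.IsElliptic] [Wd.IsGloballyMinimal],
        (∃ C : VariableChange ℚ, C • Wd = W.quadraticTwist (NumberField.discr K : ℚ)) →
        MissingUpperBoundAt Wd p :=
  upperPartner_at_of_klFlat_partner_of_thmE hP hDis h311 hDD hKY W p hc hns K hK hHN hHp hoddK hlt
    (exists_klFlatCarrier_twist_of_ramifiedOdd_of_bernoulliUnit W p hc.2.1 hns hΦ hram hodd φ ψ hφ hψ hpm hpd hφ0 hψ0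
      S₀ hS₀p hS hbal K hK hHp (discr_emod_four_eq_one_of_odd hK.1 hoddK) hlt hHN₀ hS₀N₀ hmK hdK hB)

/-! ## §2. SECOND shape (line of `E` unramified-even), `K` given -/

/-- **Stub 6 (∃-PARTNER) AT `(W, p)`, SECOND shape, PUBLISHED inputs + the twist's analytic rank** — as
`upperPartner_at_of_ramifiedOdd_of_bernoulliUnit` with the line UNRAMIFIED-EVEN (`p ∤ m`, `p ∣ d`, `φ` of ANY order, Bernoulli
unit for `θ(a) = ω̃((φ(a)·(a/|d_K|))⁻¹)` of period `m·|d_K|`); `…SubrowCarrierBernoulliEven`'s carrier into LEAD g10's door. [cite: GreenbergVatsal2000, §3 Thm. (3.11) and §2 p. 28]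
[cite: Disegni2020, Thm. 4 (§3.2)] [cite: Wuthrich2014, Thm. 16 (p. 397)] -/
theorem upperPartner_at_of_unramifiedEven_of_bernoulliUnit (hP : EisensteinPrimes.PublishedInputs)
    (hDis : padicBSD_rankOne_nonsplitMult) (h311 : thm311_hasUnitContent_iff_and_order_eq_of_lineRamifiedEven)
    (hc : X2.CellB W p) (hns : ¬ W.HasSplitMultiplicativeReductionAtPrime p)
    {Φ₀ : AddSubgroup (geomTorsion W (p : ℤ))} (hΦ : IsRationalLine W p Φ₀)
    (hunr : LineUnramifiedAt W p Φ₀) (heven : LineEven W p Φ₀)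
    {m : ℕ} [NeZero m] (φ : DirichletCharacter (ZMod p) m) {d : ℕ} [NeZero d]
    (ψ : DirichletCharacter (ZMod p) d) (hφ : φ.IsPrimitive) (hψ : ψ.IsPrimitive) (hpm : ¬ p ∣ m)
    (hpd : p ∣ d)
    (hφ0 : ∀ (σ : absoluteGaloisGroup ℚ), ∀ P ∈ Φ₀,
      σ • P = (φ ((modNCyclotomicCharacter ℚ m σ : (ZMod m)ˣ) : ZMod m)).val • P)
    (hψ0 : ∀ (σ : absoluteGaloisGroup ℚ) (P : geomTorsion W (p : ℤ)),
      σ • P - (ψ ((modNCyclotomicCharacter ℚ d σ : (ZMod d)ˣ) : ZMod d)).val • P ∈ Φ₀)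
    (S₀ : Finset (HeightOneSpectrum (𝓞 ℚ))) (hS₀p : ∀ v ∈ S₀, ((p : ℕ) : 𝓞 ℚ) ∉ v.asIdeal)
    (hS : ∀ v : HeightOneSpectrum (𝓞 ℚ), v ∉ S₀ → ((p : ℕ) : 𝓞 ℚ) ∉ v.asIdeal → W.HasGoodReductionAt v)
    (hbal : 1 + ∑ v ∈ S₀, delta W p v =
      ∑ v ∈ S₀, ((if φ (Rat.HeightOneSpectrum.natGenerator v : ZMod m) =
            (Rat.HeightOneSpectrum.natGenerator v : ZMod p)
          then sFactor p (Rat.HeightOneSpectrum.natGenerator v) else 0) +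
        (if ψ (Rat.HeightOneSpectrum.natGenerator v : ZMod d) =
            (Rat.HeightOneSpectrum.natGenerator v : ZMod p)
          then sFactor p (Rat.HeightOneSpectrum.natGenerator v) else 0)))
    (K : Type) [Field K] [NumberField K] (hK : IsImaginaryQuadratic K)
    (hHN : SatisfiesHeegnerHypothesis (W.conductorNorm ℤ) K) (hHp : SatisfiesHeegnerHypothesis p K)
    (hoddK : Odd (NumberField.discr K)) (hlt : NumberField.discr K < -4)
    {N₀ : ℕ} (hHN₀ : SatisfiesHeegnerHypothesis N₀ K)
    (hS₀N₀ : ∀ v ∈ S₀, Rat.HeightOneSpectrum.natGenerator v ∣ N₀)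
    (hmK : m.Coprime (NumberField.discr K).natAbs) (hdK : d.Coprime (NumberField.discr K).natAbs)
    (hB : ‖twistedBernoulli p 1 (m * (NumberField.discr K).natAbs) (fun a : ℕ ↦ teichmullerLift p
        (φ (a : ZMod m) * ((J((a : ℤ) | (NumberField.discr K).natAbs) : ℤ) : ZMod p))⁻¹)‖ = 1)
    (hr1 : (W.quadraticTwist (NumberField.discr K : ℚ)).analyticRank = 1) :
    ∃ (K : Type) (_ : Field K) (_ : NumberField K), IsImaginaryQuadratic K ∧
      SatisfiesHeegnerHypothesis (W.conductorNorm ℤ) K ∧ SatisfiesHeegnerHypothesis p K ∧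
      Odd (NumberField.discr K) ∧ NumberField.discr K < -4 ∧
      (W.quadraticTwist (NumberField.discr K : ℚ)).analyticRank = 1 ∧
      ∀ (Wd : WeierstrassCurve ℚ) [Wd.IsElliptic] [Wd.IsGloballyMinimal],
        (∃ C : VariableChange ℚ, C • Wd = W.quadraticTwist (NumberField.discr K : ℚ)) →
        MissingUpperBoundAt Wd p :=
  upperPartner_at_of_klFlat_partner hP hDis h311 W p hc hns K hK hHN hHp hoddK hlt hr1
    (exists_klFlatCarrier_twist_of_unramifiedEven_of_bernoulliUnit W p hc.2.1 hns hΦ hunr heven φ ψ hφ hψ hpm hpd hφ0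
      hψ0 S₀ hS₀p hS hbal K hK hHp (discr_emod_four_eq_one_of_odd hK.1 hoddK) hlt hHN₀ hS₀N₀ hmK hdK hB)

/-- **Stub 6 (∃-PARTNER) AT `(W, p)`, SECOND shape, the analytic rank DERIVED** (w5's door p650387, Keller–Yin
Thm. E PRE). [claim: KellerYin2024, status: under-review] [cite: GreenbergVatsal2000, §3 Thm. (3.11) and §2 p. 28]
[cite: DokchitserDokchitserAnnals2010, Thm. 1.4] [cite: Wuthrich2014, Thm. 16 (p. 397)] -/
theorem upperPartner_at_of_unramifiedEven_of_bernoulliUnit_of_thmE (hP : EisensteinPrimes.PublishedInputs)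
    (hDis : padicBSD_rankOne_nonsplitMult) (h311 : thm311_hasUnitContent_iff_and_order_eq_of_lineRamifiedEven)
    (hDD : ∀ (V : WeierstrassCurve ℚ) [V.IsElliptic] (ℓ : ℕ) [Fact ℓ.Prime], selmerCorank_mod_two_eq V ℓ)
    (hKY : thmE_pConverse_semistable_OPEN)
    (hc : X2.CellB W p) (hns : ¬ W.HasSplitMultiplicativeReductionAtPrime p)
    {Φ₀ : AddSubgroup (geomTorsion W (p : ℤ))} (hΦ : IsRationalLine W p Φ₀)
    (hunr : LineUnramifiedAt W p Φ₀) (heven : LineEven W p Φ₀)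
    {m : ℕ} [NeZero m] (φ : DirichletCharacter (ZMod p) m) {d : ℕ} [NeZero d]
    (ψ : DirichletCharacter (ZMod p) d) (hφ : φ.IsPrimitive) (hψ : ψ.IsPrimitive) (hpm : ¬ p ∣ m)
    (hpd : p ∣ d)
    (hφ0 : ∀ (σ : absoluteGaloisGroup ℚ), ∀ P ∈ Φ₀,
      σ • P = (φ ((modNCyclotomicCharacter ℚ m σ : (ZMod m)ˣ) : ZMod m)).val • P)
    (hψ0 : ∀ (σ : absoluteGaloisGroup ℚ) (P : geomTorsion W (p : ℤ)),
      σ • P - (ψ ((modNCyclotomicCharacter ℚ d σ : (ZMod d)ˣ) : ZMod d)).val • P ∈ Φ₀)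
    (S₀ : Finset (HeightOneSpectrum (𝓞 ℚ))) (hS₀p : ∀ v ∈ S₀, ((p : ℕ) : 𝓞 ℚ) ∉ v.asIdeal)
    (hS : ∀ v : HeightOneSpectrum (𝓞 ℚ), v ∉ S₀ → ((p : ℕ) : 𝓞 ℚ) ∉ v.asIdeal → W.HasGoodReductionAt v)
    (hbal : 1 + ∑ v ∈ S₀, delta W p v =
      ∑ v ∈ S₀, ((if φ (Rat.HeightOneSpectrum.natGenerator v : ZMod m) =
            (Rat.HeightOneSpectrum.natGenerator v : ZMod p)
          then sFactor p (Rat.HeightOneSpectrum.natGenerator v) else 0) +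
        (if ψ (Rat.HeightOneSpectrum.natGenerator v : ZMod d) =
            (Rat.HeightOneSpectrum.natGenerator v : ZMod p)
          then sFactor p (Rat.HeightOneSpectrum.natGenerator v) else 0)))
    (K : Type) [Field K] [NumberField K] (hK : IsImaginaryQuadratic K)
    (hHN : SatisfiesHeegnerHypothesis (W.conductorNorm ℤ) K) (hHp : SatisfiesHeegnerHypothesis p K)
    (hoddK : Odd (NumberField.discr K)) (hlt : NumberField.discr K < -4)
    {N₀ : ℕ} (hHN₀ : SatisfiesHeegnerHypothesis N₀ K)
    (hS₀N₀ : ∀ v ∈ S₀, Rat.HeightOneSpectrum.natGenerator v ∣ N₀)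
    (hmK : m.Coprime (NumberField.discr K).natAbs) (hdK : d.Coprime (NumberField.discr K).natAbs)
    (hB : ‖twistedBernoulli p 1 (m * (NumberField.discr K).natAbs) (fun a : ℕ ↦ teichmullerLift p
        (φ (a : ZMod m) * ((J((a : ℤ) | (NumberField.discr K).natAbs) : ℤ) : ZMod p))⁻¹)‖ = 1) :
    ∃ (K : Type) (_ : Field K) (_ : NumberField K), IsImaginaryQuadratic K ∧
      SatisfiesHeegnerHypothesis (W.conductorNorm ℤ) K ∧ SatisfiesHeegnerHypothesis p K ∧
      Odd (NumberField.discr K) ∧ NumberField.discr K < -4 ∧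
      (W.quadraticTwist (NumberField.discr K : ℚ)).analyticRank = 1 ∧
      ∀ (Wd : WeierstrassCurve ℚ) [Wd.IsElliptic] [Wd.IsGloballyMinimal],
        (∃ C : VariableChange ℚ, C • Wd = W.quadraticTwist (NumberField.discr K : ℚ)) →
        MissingUpperBoundAt Wd p :=
  upperPartner_at_of_klFlat_partner_of_thmE hP hDis h311 hDD hKY W p hc hns K hK hHN hHp hoddK hlt
    (exists_klFlatCarrier_twist_of_unramifiedEven_of_bernoulliUnit W p hc.2.1 hns hΦ hunr heven φ ψ hφ hψ hpm hpd hφ0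
      hψ0 S₀ hS₀p hS hbal K hK hHp (discr_emod_four_eq_one_of_odd hK.1 hoddK) hlt hHN₀ hS₀N₀ hmK hdK hB)

end Given

end Summit.BirchSwinnertonDyer.BirchSwinnertonDyer.Theorems.EisensteinPrimesMazurMCOnCellBTwistbackSubrowPartnerGivenBernoulli

end
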